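import Summits.AtomisticToContinuum.Crystallization.Theorems.ExcessDecayLiouvilleHcpLiouvilleBlowdownLinRows
import Summits.AtomisticToContinuum.Crystallization.Theorems.ExcessDecayLiouvilleHcpLiouvilleBlowdownRemainderSum
import Summits.AtomisticToContinuum.Crystallization.Theorems.ExcessDecayLiouvilleHcpLiouvilleBlowdownPathSup
import Summits.AtomisticToContinuum.Crystallization.Theorems.ExcessDecayLiouvilleLatticeCoordinates

/-!
# `ExcessDecayLiouville.HcpLiouville` (stmt-AtomisticToContinuum-9332), line `Sketch` (skeleton v4): the read-out of the interior estimate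

Helper for stub `stub_interior` (end of step (5) of the interior estimate for `L`-harmonic fields): once the generator
differences `F(x + A e) − F x` (`e ∈ {u₁, u₂, w₃}`) and the cross differences `F(x + (t 1 − t 0)) − F x` (`x` in
sublattice `0`) of a field `F` are bounded by `Θ` in mean square at every site of `B_ℓ(c)`, the oscillation of `F` on
`B_r(c)` about the value at a site next to the centre is `≤ C r⁵ Θ` (`7r + 24 ≤ ℓ`): every site of `B_r(c)` is reached
from that site by a lattice path of `≤ 7r + 22` generator steps inside `B_ℓ(c)` (lattice coordinates,
`abs_coord_le_norm_apply_latticeVec`) plus at most one cross step, and `#(S ∩ B_r) ≤ 32 r³`.  Registered: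
`blowdown_readout`.
All `[folklore]`; a `--supports` helper for item stmt-AtomisticToContinuum-9332, nothing here closes an item.
-/

noncomputable section

namespace Summit.AtomisticToContinuum.Crystallization.Theorems.ExcessDecayLiouville

open scoped BigOperators Topology Classical InnerProductSpace RealInnerProductSpace
open Literature.MathematicalPhysics.StatisticalMechanics
open Summit.AtomisticToContinuum.Crystallization.Theses.ExcessDecayLiouville
open Summit.AtomisticToContinuum.Crystallization.Theorems.PhononStabilityNegative

namespace Blowdown

open LevelOne

variable {t : Fin 2 → (EuclideanSpace ℝ (Fin 3))}
  {A : (EuclideanSpace ℝ (Fin 3)) →L[ℝ] (EuclideanSpace ℝ (Fin 3))}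

/-! ## Chains indexed by integers -/

/-- **Telescoping along an integer chain**: if `‖G(i+1) − G i‖ ≤ s` for `lo ≤ i < hi`, then
`‖G hi − G lo‖ ≤ (hi − lo)·s`. [folklore] -/
theorem norm_sub_le_of_chain {G : ℤ → EuclideanSpace ℝ (Fin 3)} {s : ℝ} {lo hi : ℤ} (hlh : lo ≤ hi)
    (h : ∀ i : ℤ, lo ≤ i → i < hi → ‖G (i + 1) - G i‖ ≤ s) : ‖G hi - G lo‖ ≤ (hi - lo) * s := by
  have key : ∀ n : ℕ, lo + n ≤ hi → ‖G (lo + n) - G lo‖ ≤ n * s := by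
    intro n
    induction n with
    | zero => intro _; simp
    | succ n ih =>
      intro hn
      have hn' : lo + (n : ℤ) ≤ hi := by push_cast at hn; omega
      have h1 := ih hn'
      have h2 := h (lo + n) (by omega) (by push_cast at hn; omega)
      have h3 : (lo + ((n + 1 : ℕ) : ℤ)) = lo + n + 1 := by push_cast; ring
      rw [h3]
      calc ‖G (lo + n + 1) - G lo‖ ≤ ‖G (lo + n + 1) - G (lo + n)‖ + ‖G (lo + n) - G lo‖ :=
            norm_sub_le_norm_sub_add_norm_sub _ _ _
        _ ≤ s + n * s := add_le_add h2 h1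
        _ = ((n + 1 : ℕ) : ℝ) * s := by push_cast; ring
  have h1 := key (hi - lo).toNat (by rw [Int.toNat_of_nonneg (by omega)]; omega)
  have h2 : lo + ((hi - lo).toNat : ℤ) = hi := by rw [Int.toNat_of_nonneg (by omega)]; omega
  rw [h2] at h1
  refine h1.trans (le_of_eq ?_)
  congr 1
  have : (((hi - lo).toNat : ℤ) : ℝ) = ((hi - lo : ℤ) : ℝ) := by rw [Int.toNat_of_nonneg (by omega)]
  rw [Int.cast_natCast] at this
  rw [this]; push_cast; ring

/-- **Signed walk**: if `‖G(i+1) − G i‖ ≤ s` for `min a 0 ≤ i < max a 0` (`s ≥ 0`), then `‖G a − G 0‖ ≤ |a|·s`.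
[folklore] -/
theorem norm_sub_le_of_walk {G : ℤ → EuclideanSpace ℝ (Fin 3)} {s : ℝ} (a : ℤ)
    (h : ∀ i : ℤ, min a 0 ≤ i → i < max a 0 → ‖G (i + 1) - G i‖ ≤ s) : ‖G a - G 0‖ ≤ |(a : ℝ)| * s := by
  rcases le_or_gt 0 a with ha | ha
  · have h1 := norm_sub_le_of_chain (G := G) ha (fun i hi hi' => h i (by rw [min_eq_right ha]; exact hi)
      (by rw [max_eq_left ha]; exact hi'))
    rw [Int.cast_zero, sub_zero] at h1
    rwa [abs_of_nonneg (by exact_mod_cast ha)]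
  · have h1 := norm_sub_le_of_chain (G := G) ha.le (fun i hi hi' => h i (by rw [min_eq_left ha.le]; exact hi)
      (by rw [max_eq_right ha.le]; exact hi'))
    rw [Int.cast_zero, zero_sub, norm_sub_rev] at h1
    rwa [abs_of_neg (by exact_mod_cast ha)]

/-! ## Geometry of the lattice path -/

/-- Sites of the path: `t 0 + A(z* + z(i,j,k))` is a site of sublattice `0`, at distance
`≤ dist(t 0 + A z*, c) + |i| + |j| + 2|k|` from `c`. [folklore] -/
theorem pathPoint_mem_dist (hA : Adm₀ A) {zs c : EuclideanSpace ℝ (Fin 3)} (hzs : zs ∈ Λ₀) (i j k : ℤ) :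
    (∃ w ∈ Λ₀, t 0 + A (zs + ((i : ℝ) • triangularVec₁ 1 + (j : ℝ) • triangularVec₂ 1 +
      (k : ℝ) • layerNormal (2 * Real.sqrt (2 / 3)))) = t 0 + A w) ∧
    t 0 + A (zs + ((i : ℝ) • triangularVec₁ 1 + (j : ℝ) • triangularVec₂ 1 +
      (k : ℝ) • layerNormal (2 * Real.sqrt (2 / 3)))) ∈ Sites₀ t A ∧
    dist (t 0 + A (zs + ((i : ℝ) • triangularVec₁ 1 + (j : ℝ) • triangularVec₂ 1 +
      (k : ℝ) • layerNormal (2 * Real.sqrt (2 / 3))))) c ≤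
      dist (t 0 + A zs) c + (|(i : ℝ)| + |(j : ℝ)| + 2 * |(k : ℝ)|) := by
  have hmem : zs + ((i : ℝ) • triangularVec₁ 1 + (j : ℝ) • triangularVec₂ 1 +
      (k : ℝ) • layerNormal (2 * Real.sqrt (2 / 3))) ∈ Λ₀ := hcpLiouvilleLam_add_mem hzs (latticeVec_mem_Λ₀ i j k)
  refine ⟨⟨_, hmem, rfl⟩, ⟨0, _, hmem, rfl⟩, ?_⟩
  have h1 : dist (t 0 + A (zs + ((i : ℝ) • triangularVec₁ 1 + (j : ℝ) • triangularVec₂ 1 +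
      (k : ℝ) • layerNormal (2 * Real.sqrt (2 / 3))))) (t 0 + A zs) =
      ‖A ((i : ℝ) • triangularVec₁ 1 + (j : ℝ) • triangularVec₂ 1 + (k : ℝ) • layerNormal (2 * Real.sqrt (2 / 3)))‖ := by
    rw [dist_eq_norm, map_add]; congr 1; abel
  have h2 := norm_apply_le_of_adm₀ hA ((i : ℝ) • triangularVec₁ 1 + (j : ℝ) • triangularVec₂ 1 +
    (k : ℝ) • layerNormal (2 * Real.sqrt (2 / 3)))
  have h3 := norm_latticeVec_le i j k
  have h4 := dist_triangle (t 0 + A (zs + ((i : ℝ) • triangularVec₁ 1 + (j : ℝ) • triangularVec₂ 1 +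
      (k : ℝ) • layerNormal (2 * Real.sqrt (2 / 3))))) (t 0 + A zs) c
  have h5 : 0 ≤ |(i : ℝ)| + |(j : ℝ)| + 2 * |(k : ℝ)| := by positivity
  nlinarith

/-! ## The read-out -/

/-- **Oscillation from pointwise difference bounds**: if the generator differences and the cross differences (on
sublattice `0`) of `F` are `≤ Θ` in mean square at the sites of `B_ℓ(c)`, then for `1 ≤ r`, `7r + 24 ≤ ℓ`, and a
site `p* = t 0 + A z*` with `dist p* c ≤ 11/10`, every site `p ∈ B_r(c)` has `‖F p − F p*‖² ≤ (7r + 22)² Θ`.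
[folklore] -/
theorem norm_sub_base_sq_le (hA : Adm₀ A) (hI : Inner₀ t A) {F : EuclideanSpace ℝ (Fin 3) → EuclideanSpace ℝ (Fin 3)}
    {c : EuclideanSpace ℝ (Fin 3)} {ℓ Θ r : ℝ} (hΘ : 0 ≤ Θ) (hr : 1 ≤ r) (hℓ : 7 * r + 24 ≤ ℓ)
    (hgen : ∀ e ∈ ({triangularVec₁ 1, triangularVec₂ 1, layerNormal (2 * Real.sqrt (2 / 3))} :
        Finset (EuclideanSpace ℝ (Fin 3))),
      ∀ x ∈ Sites₀ t A, dist x c ≤ ℓ → ‖F (x + A e) - F x‖ ^ 2 ≤ Θ)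
    (hcross : ∀ x ∈ Sites₀ t A, (∃ w ∈ Λ₀, x = t 0 + A w) → dist x c ≤ ℓ → ‖F (x + (t 1 - t 0)) - F x‖ ^ 2 ≤ Θ)
    {zs : EuclideanSpace ℝ (Fin 3)} (hzs : zs ∈ Λ₀) (hzsc : dist (t 0 + A zs) c ≤ 11 / 10)
    {p : EuclideanSpace ℝ (Fin 3)} (hp : p ∈ Sites₀ t A) (hpc : dist p c ≤ r) :
    ‖F p - F (t 0 + A zs)‖ ^ 2 ≤ (7 * r + 22) ^ 2 * Θ := by
  have hm₁ : triangularVec₁ 1 ∈ ({triangularVec₁ 1, triangularVec₂ 1, layerNormal (2 * Real.sqrt (2 / 3))} : Finset (EuclideanSpace ℝ (Fin 3))) := by simp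
  have hm₂ : triangularVec₂ 1 ∈ ({triangularVec₁ 1, triangularVec₂ 1, layerNormal (2 * Real.sqrt (2 / 3))} : Finset (EuclideanSpace ℝ (Fin 3))) := by simp
  have hm₃ : layerNormal (2 * Real.sqrt (2 / 3)) ∈ ({triangularVec₁ 1, triangularVec₂ 1, layerNormal (2 * Real.sqrt (2 / 3))} : Finset (EuclideanSpace ℝ (Fin 3))) := by simp
  have hs0 : 0 ≤ Real.sqrt Θ := Real.sqrt_nonneg _
  have hstep : ∀ e ∈ ({triangularVec₁ 1, triangularVec₂ 1, layerNormal (2 * Real.sqrt (2 / 3))} : Finset (EuclideanSpace ℝ (Fin 3))), ∀ x ∈ Sites₀ t A, dist x c ≤ ℓ →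
      ‖F (x + A e) - F x‖ ≤ Real.sqrt Θ := fun e he x hx hxc => by
    rw [← Real.sqrt_sq (norm_nonneg _)]; exact Real.sqrt_le_sqrt (hgen e he x hx hxc)
  -- coordinates of `p` relative to `p*`
  obtain ⟨m, zp, hzp, rfl⟩ := hp
  have hzsΛ := hzs
  obtain ⟨i₀, j₀, k₀, hzs'⟩ := hzs
  obtain ⟨i₁, j₁, k₁, hzp'⟩ := hzp
  obtain ⟨a, rfl⟩ : ∃ a, i₁ = i₀ + a := ⟨i₁ - i₀, by omega⟩
  obtain ⟨b, rfl⟩ : ∃ b, j₁ = j₀ + b := ⟨j₁ - j₀, by omega⟩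
  obtain ⟨d, rfl⟩ : ∃ d, k₁ = k₀ + d := ⟨k₁ - k₀, by omega⟩
  have hzpw : zp = zs + ((a : ℝ) • triangularVec₁ 1 + (b : ℝ) • triangularVec₂ 1 + (d : ℝ) • layerNormal (2 * Real.sqrt (2 / 3))) := by
    rw [hzp', hzs', latticeVec_add]
  -- size of the coordinates
  have hAw : ‖A ((a : ℝ) • triangularVec₁ 1 + (b : ℝ) • triangularVec₂ 1 + (d : ℝ) • layerNormal (2 * Real.sqrt (2 / 3)))‖ ≤ r + 11 / 10 + 11 / 10 := by
    have h1 : A ((a : ℝ) • triangularVec₁ 1 + (b : ℝ) • triangularVec₂ 1 + (d : ℝ) • layerNormal (2 * Real.sqrt (2 / 3))) = (t m + A zp - (t 0 + A zs)) - (t m - t 0) := by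
      have h2 : ((a : ℝ) • triangularVec₁ 1 + (b : ℝ) • triangularVec₂ 1 + (d : ℝ) • layerNormal (2 * Real.sqrt (2 / 3))) = zp - zs := by rw [hzpw]; abel
      rw [h2, map_sub]; abel
    rw [h1]
    refine (norm_sub_le _ _).trans (add_le_add ?_ (norm_t_sub_t_le_of_fin hA hI m 0))
    rw [← dist_eq_norm]
    have := dist_triangle (t m + A zp) c (t 0 + A zs)
    rw [dist_comm c] at this
    linarith
  obtain ⟨ha, hb, hd⟩ := abs_coord_le_norm_apply_latticeVec hA a b d
  have ha' : |(a : ℝ)| ≤ 400 / 189 * (r + 11 / 5) := ha.trans (by linarith)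
  have hb' : |(b : ℝ)| ≤ 400 / 189 * (r + 11 / 5) := hb.trans (by linarith)
  have hd' : |(d : ℝ)| ≤ 200 / 189 * (r + 11 / 5) := hd.trans (by linarith)
  have hP := fun i j k => pathPoint_mem_dist (t := t) (c := c) hA hzsΛ i j k
  -- bounds of the running coordinate of a signed walk
  have hrun : ∀ (q i : ℤ), min q 0 ≤ i → i < max q 0 → |(i : ℝ)| ≤ |(q : ℝ)| := by
    intro q i hi hi'
    rw [abs_le]; constructor
    · have h1 : -|(q : ℝ)| ≤ (q : ℝ) := neg_abs_le _
      have h2 : -|(q : ℝ)| ≤ 0 := by simp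
      rcases le_total q 0 with h | h
      · rw [min_eq_left h] at hi; exact h1.trans (by exact_mod_cast hi)
      · rw [min_eq_right h] at hi; exact h2.trans (by exact_mod_cast hi)
    · rcases le_total q 0 with h | h
      · rw [max_eq_right h] at hi'
        exact (show (i : ℝ) ≤ 0 by exact_mod_cast hi'.le).trans (abs_nonneg _)
      · rw [max_eq_left h] at hi'
        exact (show (i : ℝ) ≤ q by exact_mod_cast hi'.le).trans (le_abs_self _)
  -- the three walks
  have walk1 : ‖F (t 0 + A (zs + ((a : ℝ) • triangularVec₁ 1 + ((0 : ℤ) : ℝ) • triangularVec₂ 1 + ((0 : ℤ) : ℝ) • layerNormal (2 * Real.sqrt (2 / 3))))) - F (t 0 + A (zs + (((0 : ℤ) : ℝ) • triangularVec₁ 1 + ((0 : ℤ) : ℝ) • triangularVec₂ 1 + ((0 : ℤ) : ℝ) • layerNormal (2 * Real.sqrt (2 / 3)))))‖ ≤ |(a : ℝ)| * Real.sqrt Θ := by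
    refine norm_sub_le_of_walk (G := fun i : ℤ => F (t 0 + A (zs + ((i : ℝ) • triangularVec₁ 1 + ((0 : ℤ) : ℝ) • triangularVec₂ 1 + ((0 : ℤ) : ℝ) • layerNormal (2 * Real.sqrt (2 / 3)))))) a fun i hi hi' => ?_
    obtain ⟨-, hmem, hdist⟩ := hP i 0 0
    have hi2 := hrun a i hi hi'
    have hdi : dist (t 0 + A (zs + ((i : ℝ) • triangularVec₁ 1 + ((0 : ℤ) : ℝ) • triangularVec₂ 1 + ((0 : ℤ) : ℝ) • layerNormal (2 * Real.sqrt (2 / 3))))) c ≤ ℓ := by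
      refine hdist.trans ?_
      simp only [Int.cast_zero, abs_zero, add_zero, mul_zero]
      linarith
    have h := hstep _ hm₁ _ hmem hdi
    have e : t 0 + A (zs + (((i + 1 : ℤ) : ℝ) • triangularVec₁ 1 + ((0 : ℤ) : ℝ) • triangularVec₂ 1 + ((0 : ℤ) : ℝ) • layerNormal (2 * Real.sqrt (2 / 3)))) = t 0 + A (zs + ((i : ℝ) • triangularVec₁ 1 + ((0 : ℤ) : ℝ) • triangularVec₂ 1 + ((0 : ℤ) : ℝ) • layerNormal (2 * Real.sqrt (2 / 3)))) + A (triangularVec₁ 1) := by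
      rw [(latticeVec_succ i 0 0).1]; simp only [map_add]; abel
    show ‖F (t 0 + A (zs + (((i + 1 : ℤ) : ℝ) • triangularVec₁ 1 + ((0 : ℤ) : ℝ) • triangularVec₂ 1 + ((0 : ℤ) : ℝ) • layerNormal (2 * Real.sqrt (2 / 3))))) - F (t 0 + A (zs + ((i : ℝ) • triangularVec₁ 1 + ((0 : ℤ) : ℝ) • triangularVec₂ 1 + ((0 : ℤ) : ℝ) • layerNormal (2 * Real.sqrt (2 / 3)))))‖ ≤ Real.sqrt Θ
    rw [e]; exact h
  have walk2 : ‖F (t 0 + A (zs + ((a : ℝ) • triangularVec₁ 1 + (b : ℝ) • triangularVec₂ 1 + ((0 : ℤ) : ℝ) • layerNormal (2 * Real.sqrt (2 / 3))))) - F (t 0 + A (zs + ((a : ℝ) • triangularVec₁ 1 + ((0 : ℤ) : ℝ) • triangularVec₂ 1 + ((0 : ℤ) : ℝ) • layerNormal (2 * Real.sqrt (2 / 3)))))‖ ≤ |(b : ℝ)| * Real.sqrt Θ := by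
    refine norm_sub_le_of_walk (G := fun j : ℤ => F (t 0 + A (zs + ((a : ℝ) • triangularVec₁ 1 + (j : ℝ) • triangularVec₂ 1 + ((0 : ℤ) : ℝ) • layerNormal (2 * Real.sqrt (2 / 3)))))) b fun j hj hj' => ?_
    obtain ⟨-, hmem, hdist⟩ := hP a j 0
    have hj2 := hrun b j hj hj'
    have hdi : dist (t 0 + A (zs + ((a : ℝ) • triangularVec₁ 1 + (j : ℝ) • triangularVec₂ 1 + ((0 : ℤ) : ℝ) • layerNormal (2 * Real.sqrt (2 / 3))))) c ≤ ℓ := by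
      refine hdist.trans ?_
      simp only [Int.cast_zero, abs_zero, mul_zero, add_zero]
      linarith
    have h := hstep _ hm₂ _ hmem hdi
    have e : t 0 + A (zs + ((a : ℝ) • triangularVec₁ 1 + ((j + 1 : ℤ) : ℝ) • triangularVec₂ 1 + ((0 : ℤ) : ℝ) • layerNormal (2 * Real.sqrt (2 / 3)))) = t 0 + A (zs + ((a : ℝ) • triangularVec₁ 1 + (j : ℝ) • triangularVec₂ 1 + ((0 : ℤ) : ℝ) • layerNormal (2 * Real.sqrt (2 / 3)))) + A (triangularVec₂ 1) := by
      rw [(latticeVec_succ a j 0).2.1]; simp only [map_add]; abel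
    show ‖F (t 0 + A (zs + ((a : ℝ) • triangularVec₁ 1 + ((j + 1 : ℤ) : ℝ) • triangularVec₂ 1 + ((0 : ℤ) : ℝ) • layerNormal (2 * Real.sqrt (2 / 3))))) - F (t 0 + A (zs + ((a : ℝ) • triangularVec₁ 1 + (j : ℝ) • triangularVec₂ 1 + ((0 : ℤ) : ℝ) • layerNormal (2 * Real.sqrt (2 / 3)))))‖ ≤ Real.sqrt Θ
    rw [e]; exact h
  have walk3 : ‖F (t 0 + A (zs + ((a : ℝ) • triangularVec₁ 1 + (b : ℝ) • triangularVec₂ 1 + (d : ℝ) • layerNormal (2 * Real.sqrt (2 / 3))))) - F (t 0 + A (zs + ((a : ℝ) • triangularVec₁ 1 + (b : ℝ) • triangularVec₂ 1 + ((0 : ℤ) : ℝ) • layerNormal (2 * Real.sqrt (2 / 3)))))‖ ≤ |(d : ℝ)| * Real.sqrt Θ := by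
    refine norm_sub_le_of_walk (G := fun k : ℤ => F (t 0 + A (zs + ((a : ℝ) • triangularVec₁ 1 + (b : ℝ) • triangularVec₂ 1 + (k : ℝ) • layerNormal (2 * Real.sqrt (2 / 3)))))) d fun k hk hk' => ?_
    obtain ⟨-, hmem, hdist⟩ := hP a b k
    have hk2 := hrun d k hk hk'
    have hdi : dist (t 0 + A (zs + ((a : ℝ) • triangularVec₁ 1 + (b : ℝ) • triangularVec₂ 1 + (k : ℝ) • layerNormal (2 * Real.sqrt (2 / 3))))) c ≤ ℓ := by
      refine hdist.trans ?_
      linarith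
    have h := hstep _ hm₃ _ hmem hdi
    have e : t 0 + A (zs + ((a : ℝ) • triangularVec₁ 1 + (b : ℝ) • triangularVec₂ 1 + ((k + 1 : ℤ) : ℝ) • layerNormal (2 * Real.sqrt (2 / 3)))) = t 0 + A (zs + ((a : ℝ) • triangularVec₁ 1 + (b : ℝ) • triangularVec₂ 1 + (k : ℝ) • layerNormal (2 * Real.sqrt (2 / 3)))) + A (layerNormal (2 * Real.sqrt (2 / 3))) := by
      rw [(latticeVec_succ a b k).2.2]; simp only [map_add]; abel
    show ‖F (t 0 + A (zs + ((a : ℝ) • triangularVec₁ 1 + (b : ℝ) • triangularVec₂ 1 + ((k + 1 : ℤ) : ℝ) • layerNormal (2 * Real.sqrt (2 / 3))))) - F (t 0 + A (zs + ((a : ℝ) • triangularVec₁ 1 + (b : ℝ) • triangularVec₂ 1 + (k : ℝ) • layerNormal (2 * Real.sqrt (2 / 3)))))‖ ≤ Real.sqrt Θ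
    rw [e]; exact h
  -- the cross step
  obtain ⟨hmem0, hmemS, hdist3⟩ := hP a b d
  have hd3 : dist (t 0 + A (zs + ((a : ℝ) • triangularVec₁ 1 + (b : ℝ) • triangularVec₂ 1 + (d : ℝ) • layerNormal (2 * Real.sqrt (2 / 3))))) c ≤ ℓ := by
    refine hdist3.trans ?_; linarith
  have cross : ‖F (t m + A zp) - F (t 0 + A (zs + ((a : ℝ) • triangularVec₁ 1 + (b : ℝ) • triangularVec₂ 1 + (d : ℝ) • layerNormal (2 * Real.sqrt (2 / 3)))))‖ ≤ Real.sqrt Θ := by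
    have hm2 : m = 0 ∨ m = 1 := by
      rcases m with ⟨m, hm⟩
      rcases m with _ | m
      · exact Or.inl rfl
      · right; ext; simp; omega
    rcases hm2 with rfl | rfl
    · rw [← hzpw, sub_self, norm_zero]; exact hs0
    · have h := hcross _ hmemS hmem0 hd3
      have h' : ‖F (t 0 + A (zs + ((a : ℝ) • triangularVec₁ 1 + (b : ℝ) • triangularVec₂ 1 + (d : ℝ) • layerNormal (2 * Real.sqrt (2 / 3)))) + (t 1 - t 0)) -
          F (t 0 + A (zs + ((a : ℝ) • triangularVec₁ 1 + (b : ℝ) • triangularVec₂ 1 + (d : ℝ) • layerNormal (2 * Real.sqrt (2 / 3)))))‖ ≤ Real.sqrt Θ := by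
        rw [← Real.sqrt_sq (norm_nonneg _)]; exact Real.sqrt_le_sqrt h
      have e1 : t 0 + A (zs + ((a : ℝ) • triangularVec₁ 1 + (b : ℝ) • triangularVec₂ 1 + (d : ℝ) • layerNormal (2 * Real.sqrt (2 / 3)))) + (t 1 - t 0) = t 1 + A zp := by
        rw [hzpw]; abel
      rw [e1] at h'
      exact h'
  -- assemble the path
  have hzero : t 0 + A (zs + (((0 : ℤ) : ℝ) • triangularVec₁ 1 + ((0 : ℤ) : ℝ) • triangularVec₂ 1 + ((0 : ℤ) : ℝ) • layerNormal (2 * Real.sqrt (2 / 3)))) = t 0 + A zs := by simp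
  rw [hzero] at walk1
  have t1 := norm_sub_le_norm_sub_add_norm_sub (F (t m + A zp)) (F (t 0 + A (zs + ((a : ℝ) • triangularVec₁ 1 + (b : ℝ) • triangularVec₂ 1 + (d : ℝ) • layerNormal (2 * Real.sqrt (2 / 3)))))) (F (t 0 + A zs))
  have t2 := norm_sub_le_norm_sub_add_norm_sub (F (t 0 + A (zs + ((a : ℝ) • triangularVec₁ 1 + (b : ℝ) • triangularVec₂ 1 + (d : ℝ) • layerNormal (2 * Real.sqrt (2 / 3))))))
    (F (t 0 + A (zs + ((a : ℝ) • triangularVec₁ 1 + (b : ℝ) • triangularVec₂ 1 + ((0 : ℤ) : ℝ) • layerNormal (2 * Real.sqrt (2 / 3)))))) (F (t 0 + A zs))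
  have t3 := norm_sub_le_norm_sub_add_norm_sub (F (t 0 + A (zs + ((a : ℝ) • triangularVec₁ 1 + (b : ℝ) • triangularVec₂ 1 + ((0 : ℤ) : ℝ) • layerNormal (2 * Real.sqrt (2 / 3))))))
    (F (t 0 + A (zs + ((a : ℝ) • triangularVec₁ 1 + ((0 : ℤ) : ℝ) • triangularVec₂ 1 + ((0 : ℤ) : ℝ) • layerNormal (2 * Real.sqrt (2 / 3)))))) (F (t 0 + A zs))
  have htot : ‖F (t m + A zp) - F (t 0 + A zs)‖ ≤ (|(a : ℝ)| + |(b : ℝ)| + |(d : ℝ)| + 1) * Real.sqrt Θ := by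
    linarith
  have hcoef : |(a : ℝ)| + |(b : ℝ)| + |(d : ℝ)| + 1 ≤ 7 * r + 22 := by linarith
  have hn := norm_nonneg (F (t m + A zp) - F (t 0 + A zs))
  calc ‖F (t m + A zp) - F (t 0 + A zs)‖ ^ 2 ≤ ((|(a : ℝ)| + |(b : ℝ)| + |(d : ℝ)| + 1) * Real.sqrt Θ) ^ 2 :=
        pow_le_pow_left₀ hn htot 2
    _ ≤ ((7 * r + 22) * Real.sqrt Θ) ^ 2 := pow_le_pow_left₀ (by positivity) (mul_le_mul_of_nonneg_right hcoef hs0) 2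
    _ = (7 * r + 22) ^ 2 * Θ := by rw [mul_pow, Real.sq_sqrt hΘ]

end Blowdown

open LevelOne in
/-- **The read-out** (registered sub-goal `blowdown_readout`, end of step (5) of stub `stub_interior`, crux
stmt-AtomisticToContinuum-9332, line `Sketch` v4): if the generator differences and the cross differences (on
sublattice `0`) of a field `F` are `≤ Θ` in mean square at the sites of `B_ℓ(c)`, then for `1 ≤ r` with `7r + 24 ≤ ℓ`
some constant `m′` (the value at a site next to the centre) has `oscAt S F c r m′ ≤ C r⁵ Θ`. [folklore] -/
theorem blowdown_readout : ∃ C : ℝ, 0 ≤ C ∧ ∀ (t : Fin 2 → (EuclideanSpace ℝ (Fin 3)))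
    (A : (EuclideanSpace ℝ (Fin 3)) →L[ℝ] (EuclideanSpace ℝ (Fin 3))), Adm₀ A → Inner₀ t A →
    ∀ (F : (EuclideanSpace ℝ (Fin 3)) → (EuclideanSpace ℝ (Fin 3))) (c : (EuclideanSpace ℝ (Fin 3))) (ℓ Θ r : ℝ),
      0 ≤ Θ → 1 ≤ r → 7 * r + 24 ≤ ℓ →
      (∀ e ∈ ({triangularVec₁ 1, triangularVec₂ 1, layerNormal (2 * Real.sqrt (2 / 3))} :
          Finset (EuclideanSpace ℝ (Fin 3))),
        ∀ x ∈ Sites₀ t A, dist x c ≤ ℓ → ‖F (x + A e) - F x‖ ^ 2 ≤ Θ) →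
      (∀ x ∈ Sites₀ t A, (∃ w ∈ Λ₀, x = t 0 + A w) → dist x c ≤ ℓ → ‖F (x + (t 1 - t 0)) - F x‖ ^ 2 ≤ Θ) →
      ∃ m' : (EuclideanSpace ℝ (Fin 3)), Blowdown.oscAt (Sites₀ t A) F c r m' ≤ C * r ^ 5 * Θ := by
  refine ⟨32 * 29 ^ 2, by norm_num, ?_⟩
  intro t A hA hI F c ℓ Θ r hΘ hr hℓ hgen hcross
  obtain ⟨zs, hzs, hzsc⟩ := exists_site_dist_le hA t 0 c
  refine ⟨F (t 0 + A zs), ?_⟩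
  rw [Blowdown.oscAt, Blowdown.tsum_ball_eq_sum hA hI c r (fun x => ‖F x - F (t 0 + A zs)‖ ^ 2)]
  have hpt : ∀ p ∈ (finite_sites_ball hA hI c r).toFinset, ‖F p - F (t 0 + A zs)‖ ^ 2 ≤ (7 * r + 22) ^ 2 * Θ :=
    fun p hp => Blowdown.norm_sub_base_sq_le hA hI hΘ hr hℓ hgen hcross hzs hzsc p.2
      ((Blowdown.mem_ballFinset hA hI).1 hp)
  have hcard := card_sites_le hA hI c hr (finite_sites_ball hA hI c r).toFinset
    (fun q hq => (Blowdown.mem_ballFinset hA hI).1 hq)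
  calc ∑ p ∈ (finite_sites_ball hA hI c r).toFinset, ‖F p - F (t 0 + A zs)‖ ^ 2
      ≤ ∑ p ∈ (finite_sites_ball hA hI c r).toFinset, (7 * r + 22) ^ 2 * Θ := Finset.sum_le_sum hpt
    _ = (finite_sites_ball hA hI c r).toFinset.card * ((7 * r + 22) ^ 2 * Θ) := by
        rw [Finset.sum_const, nsmul_eq_mul]
    _ ≤ 32 * r ^ 3 * ((7 * r + 22) ^ 2 * Θ) := mul_le_mul_of_nonneg_right hcard (by positivity)
    _ ≤ 32 * r ^ 3 * ((29 * r) ^ 2 * Θ) := by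
        have : 7 * r + 22 ≤ 29 * r := by linarith
        have h0 : 0 ≤ 7 * r + 22 := by linarith
        gcongr
    _ = 32 * 29 ^ 2 * r ^ 5 * Θ := by ring

end Summit.AtomisticToContinuum.Crystallization.Theorems.ExcessDecayLiouville

end
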